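import Summits.BirchSwinnertonDyer.BirchSwinnertonDyer.Theorems.ClassRecordThreeCartanNaturalDefs
import HarnessLib

/-!
# The double-coset operator `𝒯♭` on the induced module — §I.0–§I.2 of the `doublecoset` certificate for crux 24801 `CartanOnePlaceDegreeLawAtThree`

Lift-only port (cell bsd-stepL, SUMMON key `k5-lift1`, director-bsd (734)(1) CONCUR 2026-08-31) of §I.0–§I.2 (source lines 2019–2310) of the crux-ideate workfile
`Summits/BirchSwinnertonDyer/BirchSwinnertonDyer/Cruxes/CartanOnePlaceDegreeLawAtThree/Lines/doublecoset.lean` (lineage `cruxidea-stmt-BirchSwinnertonDyer-24801-1`, generation 22,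
commit 721e9ccbdf4b, sha256-16 d3adee7328f6a76c, 2876 l.; farm rc 0, sorries 4 = its §4 stubs, none of which is lifted; referee landing record `VERDICT-DOUBLECOSET-G22-g88.md`).
Declarations, statements and proofs below are BYTE-IDENTICAL to the source; the only edits are the namespace (`…Cruxes.CartanOnePlaceDegreeLawAtThree.Doublecoset` ↦
`…Theorems.CartanDoubleCoset`, shared by the nine `ClassRecordThreeCartanSupply*` modules), the imports ∕ `open`s each module needs, and one-line docstrings added where the source
had none. Nothing is re-stated, weakened or re-proved.

CONTENT (generation 22, real proofs, tree bricks only; independent of the other `ClassRecordThreeCartanSupply*` modules). §I.0 function-valued bookkeeping on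
`IndCuspForm = Ind_{redHom(ι(O₀'¹))}^{GL₂(𝔽_q)} S₂(Γ̄(q))`: right translation `rTrans`, the underlying functions `coeLin` (injective, intertwines `indRep`), slashing
finite sums, the equivariance on functions (`coe_apply_redHom_mul`), the NORMALITY TRICK `mem_torusCoset_of_mul_mem` (strong approximation). §I.1 (SIMREP) data at a good
prime `ℓ ∤ q·D·M·∏_C p` (`SimRep`, `nonempty_simRep` from `Charext.InertHecke.simultaneousHeckeReps_holds`; `fintypeQuot` from `deg T_ℓ = ℓ + 1`): representatives
`α_i = g_i · i.out`, lifts `x_i ∈ O`, COMPONENT SHIFTS `c_i = red(x_i) ∈ T_η` (`SimRep.c_mem_torus`), the Hecke datum of `ι(O₀'¹)` (`SimRep.datum`, permutations `perm`,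
units `twist`, `c_mul_redHom`). §I.2 THE OPERATOR `(𝒯♭ f)(ḡ) := Σ_i ⇑(f (c_i ḡ)) ∣[2] α_i` (`SimRep.heckeFn`, linear `SimRep.heckeLin`) with (T1) translation
`heckeFn_mul` and (T2) equivariance `heckeFn_redHom_mul`.

HONEST: a `--supports stmt-BirchSwinnertonDyer-24801` helper module; it proves NOTHING about NUM ∕ NUM♮ (items 24801 ∕ 32276) or crux 19109 for any curve — the leaves (MO1)
`SplitLevelMultiplicityOne`, (BCV) `BorelCubicEigenDocking`, (VAN) `NonsplitTorusCubicVanishing`, (DS) ∧ (JLᶜ) stay OPEN; registry `Lines/petarea.lean` rev 8 untouched; BSD is proved for no curve.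
-/

set_option linter.dupNamespace false  -- `Summit.BirchSwinnertonDyer.BirchSwinnertonDyer.…` (summit = problem), as every file of this directory
set_option autoImplicit false

noncomputable section

open scoped Classical MatrixGroups
open Matrix

namespace Summit.BirchSwinnertonDyer.BirchSwinnertonDyer.Theorems.CartanDoubleCoset

open Summit.BirchSwinnertonDyer.BirchSwinnertonDyer.Theorems
open Summit.BirchSwinnertonDyer.BirchSwinnertonDyer.Theorems.CartanDegree (HasRatEigenvalue)
open Summit.BirchSwinnertonDyer.BirchSwinnertonDyer.Theorems.CartanTorusCubeCut (torusSubgroup mem_torusSubgroup lin linGL linGL_coe lin_comm torusSubgroup_isCyclic card_torusSubgroup)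
open Summit.BirchSwinnertonDyer.BirchSwinnertonDyer.Theorems.CartanCover (splitGen mem_splitTorus_iff)
open Summit.BirchSwinnertonDyer.BirchSwinnertonDyer.Theorems.CartanCover.Charext.InertHecke (upperUnip lowerUnip coe_upperUnip coe_lowerUnip upperUnip_mul upperUnip_zero exists_unip_factorization)
open scoped Pointwise ModularForm NumberField
open Module UpperHalfPlane
open Literature.NumberTheory.Automorphic WeierstrassCurve Literature.NumberTheory.EllipticCurves Literature.NumberTheory.EllipticCurves.ModularForms
open Literature.NumberTheory.EllipticCurves.Rank1Residual Summit.BirchSwinnertonDyer.Rank1Residual Literature.NumberTheory.GaloisRepresentations NumberField IsDedekindDomain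
open Summit.BirchSwinnertonDyer.BirchSwinnertonDyer.Theorems.CartanCover
open Summit.BirchSwinnertonDyer.BirchSwinnertonDyer.Theorems.CartanCover.CMRank
open Summit.BirchSwinnertonDyer.BirchSwinnertonDyer.Theorems.CartanTorusCubeCut
open Summit.BirchSwinnertonDyer.BirchSwinnertonDyer.Theorems.CartanDegree (cubicNewvectorChar HasRatEigenvalue)

/-! ## §I (NEW, generation 22): THE DOUBLE-COSET OPERATOR — the structural leaf (HF) of generation 21 DISCHARGED (function-valued form) from tree bricks:
(SIMREP) `Charext.InertHecke.simultaneousHeckeReps_holds`, strong approximation `Charext.strongApproxAtCartanPlace_holds`, the dockings, `deg T_ℓ = ℓ + 1`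
(`cartanLevel_card_heckeCosets_eq_holds`). ONE family of representatives `α_i ∈ ι(O(ℓ))` with component shifts `c_i = red(α_i) ∈ T_η` serves `Γ̄(q)`, `X.Gamma`
and every split sub-order `O_s` at once: `(𝒯♭ f)(ḡ) := Σ_i f(c_i ḡ) ∣[2] α_i`. -/

section HeckeCut

variable {D M : ℕ} {C : Finset ℕ} {X : CartanLevelCurveData D M C} {q : ℕ} [Fact q.Prime]

/-! ### §I.0 Function-valued bookkeeping on the induced module -/

/-- Right translation of functions on `GL₂(𝔽_q)` (the image of `indRep` under `coeLin`). -/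
def rTrans (g : GL (Fin 2) (ZMod q)) : (GL (Fin 2) (ZMod q) → ℍ → ℂ) →ₗ[ℂ] (GL (Fin 2) (ZMod q) → ℍ → ℂ) where
  toFun φ := fun h => φ (h * g)
  map_add' _ _ := rfl
  map_smul' _ _ := rfl

/-- `rTrans g φ h = φ (h g)`. -/
@[simp] theorem rTrans_apply (g h : GL (Fin 2) (ZMod q)) (φ : GL (Fin 2) (ZMod q) → ℍ → ℂ) : rTrans g φ h = φ (h * g) := rfl

/-- The underlying functions `ḡ ↦ ⇑(f ḡ)` of an element of the induced module (a `ℂ`-linear map). -/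
def coeLin (R : CoverReduction X q) : R.IndCuspForm →ₗ[ℂ] (GL (Fin 2) (ZMod q) → ℍ → ℂ) where
  toFun f := fun gb => ⇑(f.1 gb)
  map_add' f g := by
    funext gb
    show ⇑(f.1 gb + g.1 gb) = ⇑(f.1 gb) + ⇑(g.1 gb)
    exact CuspForm.coe_add _ _
  map_smul' a f := by
    funext gb
    show ⇑(a • f.1 gb) = a • ⇑(f.1 gb)
    exact CuspForm.IsGLPos.coe_smul _ _

/-- `coeLin R f ḡ = ⇑(f ḡ)`. -/
@[simp] theorem coeLin_apply (R : CoverReduction X q) (f : R.IndCuspForm) (gb : GL (Fin 2) (ZMod q)) : coeLin R f gb = ⇑(f.1 gb) := rfl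

/-- `coeLin` intertwines `indRep g` with the right translation `rTrans g`. -/
theorem coeLin_indRep (R : CoverReduction X q) (g : GL (Fin 2) (ZMod q)) (f : R.IndCuspForm) :
    coeLin R (R.indRep g f) = rTrans g (coeLin R f) := rfl

/-- `coeLin` is injective (a cusp form is determined by its function). -/
theorem coeLin_injective (R : CoverReduction X q) : Function.Injective (coeLin R) := by
  intro f g h
  apply Subtype.ext
  funext gb
  apply CuspForm.ext
  intro τ
  exact congr_fun (congr_fun h gb) τ

/-- Slashing distributes over finite sums. -/
theorem sum_slash {ι : Type*} (s : Finset ι) (φ : ι → ℍ → ℂ) (g : GL (Fin 2) ℝ) :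
    (∑ i ∈ s, φ i) ∣[(2 : ℤ)] g = ∑ i ∈ s, (φ i ∣[(2 : ℤ)] g) := by
  induction s using Finset.induction_on with
  | empty => simp [SlashAction.zero_slash]
  | insert a s ha ih => rw [Finset.sum_insert ha, Finset.sum_insert ha, SlashAction.add_slash, ih]

/-- For `det g > 0` the weight-2 slash is `ℂ`-linear (no complex conjugation). -/
theorem smul_slash_of_det_pos (a : ℂ) (φ : ℍ → ℂ) {g : GL (Fin 2) ℝ} (hg : 0 < g.det.val) :
    (a • φ) ∣[(2 : ℤ)] g = a • (φ ∣[(2 : ℤ)] g) := by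
  have hσ : UpperHalfPlane.σ g a = a := by simp only [UpperHalfPlane.σ, if_pos hg]; rfl
  rw [ModularForm.smul_slash, hσ]

omit [Fact q.Prime] in
/-- `det γ⁻¹ > 0` for `γ ∈ ι(O₀'¹)`. -/
theorem det_inv_pos (γ : coverUnits X q) : 0 < ((γ : GL (Fin 2) ℝ)⁻¹).det.val := by
  rw [map_inv, Units.val_inv_eq_inv_val]
  exact inv_pos.mpr (det_pos_of_mem_coverUnits X q γ.2)

/-- The equivariance of the induced module, on functions: `⇑(f (redHom γ · ḡ)) = ⇑(f ḡ) ∣[2] γ⁻¹`. -/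
theorem coe_apply_redHom_mul (R : CoverReduction X q) (f : R.IndCuspForm) (γ : coverUnits X q) (gb : GL (Fin 2) (ZMod q)) :
    ⇑(f.1 (R.redHom γ * gb)) = ⇑(f.1 gb) ∣[(2 : ℤ)] ((γ : GL (Fin 2) ℝ)⁻¹) := by
  rw [f.2 γ gb, coverRep_apply, coe_coverSlash]

/-- **NORMALITY TRICK** (`redHom(ι(O₀'¹)) = SL₂(𝔽_q)` is normal): for `c ∈ T_η`, `c·ḡ ∈ redHom(ι(O₀'¹))·T_η ⟹ ḡ ∈ redHom(ι(O₀'¹))·T_η` (strong approximation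
applied to `c⁻¹ · redHom γ · c`). -/
theorem mem_torusCoset_of_mul_mem (R : CoverReduction X q) (hq : q ∈ C) {cc gb : GL (Fin 2) (ZMod q)} (hc : cc ∈ torusSubgroup R.η)
    (h : cc * gb ∈ R.torusCoset (torusSubgroup R.η)) : gb ∈ R.torusCoset (torusSubgroup R.η) := by
  obtain ⟨γ, hγ⟩ := h
  have h1 : Matrix.GeneralLinearGroup.det (R.redHom γ) = 1 :=
    Units.ext (by rw [Matrix.GeneralLinearGroup.val_det_apply, R.det_redHom, Units.val_one])
  have hdet : Matrix.det (((cc⁻¹ * R.redHom γ * cc : GL (Fin 2) (ZMod q)) : Matrix (Fin 2) (Fin 2) (ZMod q))) = 1 := by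
    rw [← Matrix.GeneralLinearGroup.val_det_apply, map_mul, map_mul, h1, mul_one, map_inv, inv_mul_cancel, Units.val_one]
  obtain ⟨γ₁, hγ₁⟩ := Charext.strongApproxAtCartanPlace_holds D M C X q hq R _ hdet
  refine ⟨γ₁, ?_⟩
  rw [hγ₁]
  have e : (cc⁻¹ * R.redHom γ * cc)⁻¹ * gb = cc⁻¹ * ((R.redHom γ)⁻¹ * (cc * gb)) := by group
  rw [e]
  exact (torusSubgroup R.η).mul_mem ((torusSubgroup R.η).inv_mem hc) hγ

/-! ### §I.1 Simultaneous representatives at a good prime: lifts to `O`, component shifts `c_i ∈ T_η`, the Hecke datum of `ι(O₀'¹)` -/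

/-- **SIMREP data at a good prime `ℓ`** — the `Γ`-translates of `simultaneousHeckeReps_holds`, bundled with the hypotheses on `ℓ`
((i) `ι(O₀'¹)`-inequivalence `disj`, (ii) right stability `stab`, (iv) covering of `ι(O₀'(ℓ))` `cover`; the two-sided test (iii) is not needed here). -/
structure SimRep (X : CartanLevelCurveData D M C) (q ℓ : ℕ) : Type where
  prime : ℓ.Prime
  good : ¬ ℓ ∣ q * (D * M * ∏ p ∈ C, p)
  g : Quotient (X.heckeSetoid ℓ) → GL (Fin 2) ℝ
  g_mem : ∀ i, g i ∈ X.Gamma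
  disj : ∀ (i j : Quotient (X.heckeSetoid ℓ)) (u : GL (Fin 2) ℝ), u ∈ coverUnits X q →
    g i * ((i.out : X.heckeSet ℓ) : GL (Fin 2) ℝ) = u * (g j * ((j.out : X.heckeSet ℓ) : GL (Fin 2) ℝ)) → i = j
  stab : ∀ u ∈ coverUnits X q, ∀ (i : Quotient (X.heckeSetoid ℓ)), ∃ j : Quotient (X.heckeSetoid ℓ),
    g i * ((i.out : X.heckeSet ℓ) : GL (Fin 2) ℝ) * u * (g j * ((j.out : X.heckeSet ℓ) : GL (Fin 2) ℝ))⁻¹ ∈ coverUnits X q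
  cover : ∀ a ∈ Charext.InertHecke.unitsHeckeSet X.ι (O := coverOrder X q) ℓ, ∃ (i : Quotient (X.heckeSetoid ℓ)),
    ∃ u ∈ coverUnits X q, u * a = g i * ((i.out : X.heckeSet ℓ) : GL (Fin 2) ℝ)

/-- (SIMREP) supplies the data at every good prime. -/
theorem nonempty_simRep (hq : q ∈ C) {ℓ : ℕ} (hℓ : ℓ.Prime) (hgood : ¬ ℓ ∣ q * (D * M * ∏ p ∈ C, p)) : Nonempty (SimRep X q ℓ) := by
  obtain ⟨g, h1, h2, h3, -, h5⟩ := Charext.InertHecke.simultaneousHeckeReps_holds D M C X q hq ℓ hℓ hgood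
  exact ⟨⟨hℓ, hgood, g, h1, h2, h3, h5⟩⟩

omit [Fact q.Prime] in
/-- `¬ ℓ ∣ q·D·M·∏_C p ⟹ ¬ ℓ ∣ D·M·∏_C p`. -/
theorem good_of_good {ℓ : ℕ} (h : ¬ ℓ ∣ q * (D * M * ∏ p ∈ C, p)) : ¬ ℓ ∣ D * M * ∏ p ∈ C, p :=
  fun h' => h (dvd_mul_of_dvd_right h' q)

/-- `Γ∖ι(O(ℓ))` is a finite type at a good prime (`deg T_ℓ = ℓ + 1`, `cartanLevel_card_heckeCosets_eq_holds`). -/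
abbrev fintypeQuot (X : CartanLevelCurveData D M C) {ℓ : ℕ} (hℓ : ℓ.Prime) (h : ¬ ℓ ∣ D * M * ∏ p ∈ C, p) :
    Fintype (Quotient (X.heckeSetoid ℓ)) :=
  @Fintype.ofFinite _ (cartanLevel_card_heckeCosets_eq_holds D M C X ℓ hℓ h).1

namespace SimRep

variable {ℓ : ℕ} (S : SimRep X q ℓ) (R : CoverReduction X q)

/-- the representatives `α_i = g_i · i.out ∈ ι(O(ℓ))`. -/
def α (i : Quotient (X.heckeSetoid ℓ)) : GL (Fin 2) ℝ := S.g i * ((i.out : X.heckeSet ℓ) : GL (Fin 2) ℝ)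

omit [Fact q.Prime] in
/-- unfolding `α`. -/
theorem α_def (i : Quotient (X.heckeSetoid ℓ)) : S.α i = S.g i * ((i.out : X.heckeSet ℓ) : GL (Fin 2) ℝ) := rfl

omit [Fact q.Prime] in
/-- `det g_i = 1`. -/
theorem det_g (i : Quotient (X.heckeSetoid ℓ)) : Matrix.det ((S.g i : GL (Fin 2) ℝ) : Matrix (Fin 2) (Fin 2) ℝ) = 1 := by
  have h : (S.g i).det = 1 := (S.g_mem i).2.2
  rw [← Matrix.GeneralLinearGroup.val_det_apply, h, Units.val_one]

omit [Fact q.Prime] in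
/-- `det α_i = ℓ`. -/
theorem det_α (i : Quotient (X.heckeSetoid ℓ)) : Matrix.det ((S.α i : GL (Fin 2) ℝ) : Matrix (Fin 2) (Fin 2) ℝ) = (ℓ : ℝ) := by
  rw [α, Matrix.GeneralLinearGroup.coe_mul, Matrix.det_mul, S.det_g, one_mul]
  exact (i.out : X.heckeSet ℓ).2.2

omit [Fact q.Prime] in
/-- `det α_i > 0`. -/
theorem det_α_pos (i : Quotient (X.heckeSetoid ℓ)) : 0 < (S.α i).det.val := by
  rw [Matrix.GeneralLinearGroup.val_det_apply, S.det_α]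
  exact_mod_cast S.prime.pos

omit [Fact q.Prime] in
/-- `α_i ∈ ι(O)`: `α_i = ι(x)` for some `x ∈ O`. -/
theorem exists_mem_O (i : Quotient (X.heckeSetoid ℓ)) : ∃ x ∈ X.O, X.ι x = ((S.α i : GL (Fin 2) ℝ) : Matrix (Fin 2) (Fin 2) ℝ) := by
  obtain ⟨⟨x₁, hx₁, hx₁g⟩, -, -⟩ := S.g_mem i
  obtain ⟨⟨x₂, hx₂, hx₂a⟩, -⟩ := (i.out : X.heckeSet ℓ).2
  refine ⟨x₁ * x₂, X.isOrder.mul_mem x₁ hx₁ x₂ hx₂, ?_⟩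
  rw [map_mul, hx₁g, hx₂a, α, Matrix.GeneralLinearGroup.coe_mul]

/-- the lift `x_i ∈ O ⊆ O₀'` of `α_i`. -/
def lift (i : Quotient (X.heckeSetoid ℓ)) : coverSubring X q :=
  ⟨Classical.choose (S.exists_mem_O i), le_coverOrder X q (Classical.choose_spec (S.exists_mem_O i)).1⟩

omit [Fact q.Prime] in
/-- the lift `x_i` lies in `O`. -/
theorem lift_mem_O (i : Quotient (X.heckeSetoid ℓ)) : (S.lift i : X.B) ∈ X.O := (Classical.choose_spec (S.exists_mem_O i)).1

omit [Fact q.Prime] in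
/-- `ι(x_i) = α_i`. -/
theorem ι_lift (i : Quotient (X.heckeSetoid ℓ)) : X.ι (S.lift i : X.B) = ((S.α i : GL (Fin 2) ℝ) : Matrix (Fin 2) (Fin 2) ℝ) :=
  (Classical.choose_spec (S.exists_mem_O i)).2

include S in
/-- `ℓ̄ ≠ 0` in `𝔽_q` (`ℓ ≠ q` since `ℓ` is good). -/
theorem natCast_ne_zero : (ℓ : ZMod q) ≠ 0 := by
  intro h
  rw [ZMod.natCast_eq_zero_iff] at h
  have hqP : q.Prime := Fact.out
  have hql : q = ℓ := (Nat.prime_dvd_prime_iff_eq hqP S.prime).mp h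
  exact S.good (Dvd.intro _ (by rw [hql]))

/-- `det red(x_i) = ℓ̄` (reduced norm). -/
theorem det_red_lift (i : Quotient (X.heckeSetoid ℓ)) : (R.red (S.lift i)).det = (ℓ : ZMod q) := by
  obtain ⟨n, hn, hdet⟩ := R.det_red (S.lift i)
  have h := AlgHom.det_eq_reducedNorm X.ι (S.lift i : X.B)
  rw [S.ι_lift, S.det_α, hn] at h
  have h2 : (n : ℝ) = (ℓ : ℝ) := by
    have e : (algebraMap ℚ ℝ) (n : ℚ) = (n : ℝ) := by simp
    rw [← e]; exact h.symm
  have h3 : n = ℓ := by exact_mod_cast h2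
  rw [hdet, h3, Int.cast_natCast]

/-- **the component shift `c_i := red(x_i) ∈ GL₂(𝔽_q)`** (`det c_i = ℓ̄ ≠ 0`). -/
def c (i : Quotient (X.heckeSetoid ℓ)) : GL (Fin 2) (ZMod q) :=
  Matrix.GeneralLinearGroup.mkOfDetNeZero (R.red (S.lift i)) (by rw [S.det_red_lift R]; exact S.natCast_ne_zero)

/-- the matrix of `c_i` is `red(x_i)`. -/
@[simp] theorem coe_c (i : Quotient (X.heckeSetoid ℓ)) : ((S.c R i : GL (Fin 2) (ZMod q)) : Matrix (Fin 2) (Fin 2) (ZMod q)) = R.red (S.lift i) := rfl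

/-- `c_i ∈ T_η` (`x_i ∈ O`, and `red(O) = 𝔽_q[η]`). -/
theorem c_mem_torus (i : Quotient (X.heckeSetoid ℓ)) : S.c R i ∈ torusSubgroup R.η := by
  rw [mem_torusSubgroup, coe_c]
  obtain ⟨a, b, hab⟩ := (R.mem_O_iff (S.lift i)).mp (S.lift_mem_O i)
  rw [hab]
  simp only [add_mul, mul_add, smul_mul_assoc, mul_smul_comm, one_mul, mul_one]

omit [Fact q.Prime] in
/-- (SIMREP)(i) for the `α_i`: pairwise `ι(O₀'¹)`-inequivalence. -/
theorem disj' : ∀ (i j : Quotient (X.heckeSetoid ℓ)) (u : GL (Fin 2) ℝ), u ∈ coverUnits X q → S.α i = u * S.α j → i = j :=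
  fun i j u hu h => S.disj i j u hu h

omit [Fact q.Prime] in
/-- (SIMREP)(ii) for the `α_i`: right `ι(O₀'¹)`-stability. -/
theorem stab' : ∀ (γ : coverUnits X q) (i : Quotient (X.heckeSetoid ℓ)), ∃ j, S.α i * γ * (S.α j)⁻¹ ∈ coverUnits X q :=
  fun γ i => S.stab γ γ.2 i

variable [Fintype (Quotient (X.heckeSetoid ℓ))]

/-- the Hecke datum of `ι(O₀'¹)` on the simultaneous representatives (`HeckeDatum.ofStable`). -/
def datum : Charext.InertHecke.HeckeDatum (coverUnits X q) (Quotient (X.heckeSetoid ℓ)) :=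
  Charext.InertHecke.HeckeDatum.ofStable S.α S.disj' S.stab'

omit [Fact q.Prime] in
/-- the Hecke datum's representatives are the `α_i`. -/
theorem datum_α : (S.datum).α = S.α := Charext.InertHecke.HeckeDatum.ofStable_α _ _ _

/-- the permutation `σ_γ` of the representatives induced by right multiplication by `γ ∈ ι(O₀'¹)`. -/
def perm (γ : coverUnits X q) : Equiv.Perm (Quotient (X.heckeSetoid ℓ)) := S.datum.σ γ

/-- the unit `γ'_i := α_i γ α_{σ i}⁻¹ ∈ ι(O₀'¹)`. -/
def twist (γ : coverUnits X q) (i : Quotient (X.heckeSetoid ℓ)) : coverUnits X q :=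
  ⟨S.α i * γ * (S.α (S.perm γ i))⁻¹, by have h := S.datum.mem γ i; rwa [S.datum_α] at h⟩

omit [Fact q.Prime] in
/-- the matrix of `γ'_i`. -/
theorem coe_twist (γ : coverUnits X q) (i : Quotient (X.heckeSetoid ℓ)) :
    ((S.twist γ i : coverUnits X q) : GL (Fin 2) ℝ) = S.α i * γ * (S.α (S.perm γ i))⁻¹ := rfl

omit [Fact q.Prime] in
/-- `α_i γ = γ'_i α_{σ i}`. -/
theorem α_mul (γ : coverUnits X q) (i : Quotient (X.heckeSetoid ℓ)) :
    S.α i * (γ : GL (Fin 2) ℝ) = (S.twist γ i : GL (Fin 2) ℝ) * S.α (S.perm γ i) := by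
  rw [coe_twist, inv_mul_cancel_right]

omit [Fact q.Prime] in
/-- `γ'_i⁻¹ α_i = α_{σ i} γ⁻¹`. -/
theorem twist_inv_mul_α (γ : coverUnits X q) (i : Quotient (X.heckeSetoid ℓ)) :
    ((S.twist γ i : coverUnits X q) : GL (Fin 2) ℝ)⁻¹ * S.α i = S.α (S.perm γ i) * (γ : GL (Fin 2) ℝ)⁻¹ := by
  rw [coe_twist]; group

omit [Fact q.Prime] in
/-- the lifts follow: `x_i · lift γ = lift γ'_i · x_{σ i}` in `O₀'` (injectivity of `ι`). -/
theorem lift_mul_unitLift (γ : coverUnits X q) (i : Quotient (X.heckeSetoid ℓ)) :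
    S.lift i * unitLift γ = unitLift (S.twist γ i) * S.lift (S.perm γ i) := by
  apply Subtype.ext
  apply X.ι_injective
  rw [Subring.coe_mul, Subring.coe_mul, map_mul, map_mul, S.ι_lift, ι_unitLift, ι_unitLift, S.ι_lift,
    ← Matrix.GeneralLinearGroup.coe_mul, ← Matrix.GeneralLinearGroup.coe_mul, S.α_mul γ i]

/-- **reductions follow**: `c_i · redHom γ = redHom γ'_i · c_{σ i}`. -/
theorem c_mul_redHom (γ : coverUnits X q) (i : Quotient (X.heckeSetoid ℓ)) :
    S.c R i * R.redHom γ = R.redHom (S.twist γ i) * S.c R (S.perm γ i) := by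
  apply Units.ext
  rw [Units.val_mul, Units.val_mul, coe_c, coe_c, CoverReduction.coe_redHom, CoverReduction.coe_redHom, ← map_mul, ← map_mul,
    S.lift_mul_unitLift γ i]

/-! ### §I.2 The operator `𝒯♭` and its two structural identities -/

/-- **THE DOUBLE-COSET OPERATOR** `(𝒯♭ f)(ḡ) := Σ_i ⇑(f (c_i ḡ)) ∣[2] α_i` (a function `ℍ → ℂ` per component). -/
def heckeFn (f : R.IndCuspForm) (gb : GL (Fin 2) (ZMod q)) : ℍ → ℂ :=
  ∑ i : Quotient (X.heckeSetoid ℓ), (⇑(f.1 (S.c R i * gb)) ∣[(2 : ℤ)] (S.α i))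

/-- unfolding `𝒯♭`. -/
theorem heckeFn_def (f : R.IndCuspForm) (gb : GL (Fin 2) (ZMod q)) :
    S.heckeFn R f gb = ∑ i : Quotient (X.heckeSetoid ℓ), (⇑(f.1 (S.c R i * gb)) ∣[(2 : ℤ)] (S.α i)) := rfl

/-- (T1) translation: `(𝒯♭ f)(ḡ h) = (𝒯♭ (h·f))(ḡ)`. -/
theorem heckeFn_mul (f : R.IndCuspForm) (gb h : GL (Fin 2) (ZMod q)) : S.heckeFn R f (gb * h) = S.heckeFn R (R.indRep h f) gb := by
  simp only [heckeFn, CoverReduction.indRep_apply, mul_assoc]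

/-- (T2) **equivariance**: `(𝒯♭ f)(redHom γ · ḡ) = ((𝒯♭ f)(ḡ)) ∣[2] γ⁻¹` — the permutation `σ_γ` of the simultaneous representatives. -/
theorem heckeFn_redHom_mul (f : R.IndCuspForm) (γ : coverUnits X q) (gb : GL (Fin 2) (ZMod q)) :
    S.heckeFn R f (R.redHom γ * gb) = (S.heckeFn R f gb) ∣[(2 : ℤ)] ((γ : GL (Fin 2) ℝ)⁻¹) := by
  rw [heckeFn_def, heckeFn_def, sum_slash]
  have hterm : ∀ i, ⇑(f.1 (S.c R i * (R.redHom γ * gb))) ∣[(2 : ℤ)] (S.α i)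
      = (⇑(f.1 (S.c R (S.perm γ i) * gb)) ∣[(2 : ℤ)] (S.α (S.perm γ i))) ∣[(2 : ℤ)] ((γ : GL (Fin 2) ℝ)⁻¹) := by
    intro i
    rw [← mul_assoc, S.c_mul_redHom R γ i, mul_assoc, coe_apply_redHom_mul, ← SlashAction.slash_mul, ← SlashAction.slash_mul,
      S.twist_inv_mul_α]
  simp_rw [hterm]
  exact Equiv.sum_comp (S.perm γ) (fun j => (⇑(f.1 (S.c R j * gb)) ∣[(2 : ℤ)] (S.α j)) ∣[(2 : ℤ)] ((γ : GL (Fin 2) ℝ)⁻¹))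

/-- `𝒯♭` is additive. -/
theorem heckeFn_add (f g : R.IndCuspForm) (gb : GL (Fin 2) (ZMod q)) :
    S.heckeFn R (f + g) gb = S.heckeFn R f gb + S.heckeFn R g gb := by
  rw [heckeFn_def, heckeFn_def, heckeFn_def, ← Finset.sum_add_distrib]
  refine Finset.sum_congr rfl fun i _ => ?_
  rw [show (f + g).1 (S.c R i * gb) = f.1 (S.c R i * gb) + g.1 (S.c R i * gb) from rfl, CuspForm.coe_add, SlashAction.add_slash]

/-- `𝒯♭` is homogeneous. -/
theorem heckeFn_smul (a : ℂ) (f : R.IndCuspForm) (gb : GL (Fin 2) (ZMod q)) :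
    S.heckeFn R (a • f) gb = a • S.heckeFn R f gb := by
  rw [heckeFn_def, heckeFn_def, Finset.smul_sum]
  refine Finset.sum_congr rfl fun i _ => ?_
  rw [show (a • f).1 (S.c R i * gb) = a • f.1 (S.c R i * gb) from rfl, CuspForm.IsGLPos.coe_smul,
    smul_slash_of_det_pos _ _ (S.det_α_pos i)]

/-- `𝒯♭` as a `ℂ`-linear map `IndCuspForm → (GL₂(𝔽_q) → ℍ → ℂ)`. -/
def heckeLin : R.IndCuspForm →ₗ[ℂ] (GL (Fin 2) (ZMod q) → ℍ → ℂ) where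
  toFun := S.heckeFn R
  map_add' f g := funext fun gb => S.heckeFn_add R f g gb
  map_smul' a f := funext fun gb => S.heckeFn_smul R a f gb

/-- `heckeLin` is `heckeFn`. -/
@[simp] theorem heckeLin_apply (f : R.IndCuspForm) : S.heckeLin R f = S.heckeFn R f := rfl

/-- (T1) for the linear map: `𝒯♭ (h·f) = rTrans h (𝒯♭ f)`. -/
theorem heckeLin_indRep (h : GL (Fin 2) (ZMod q)) (f : R.IndCuspForm) : S.heckeLin R (R.indRep h f) = rTrans h (S.heckeLin R f) := by
  funext gb
  rw [heckeLin_apply, rTrans_apply, heckeLin_apply, S.heckeFn_mul R f gb h]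

end SimRep


end HeckeCut

end Summit.BirchSwinnertonDyer.BirchSwinnertonDyer.Theorems.CartanDoubleCoset

end
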